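import Mathlib
import Summits.ResolutionOfSingularities.ResolutionOfSingularities.Theorems.WildQuotientsWildQuotientResolutionTerminalBlowupSpec
import Summits.ResolutionOfSingularities.ResolutionOfSingularities.Theorems.WildQuotientsWildQuotientResolutionTerminalBlowupAugSup
import Summits.ResolutionOfSingularities.ResolutionOfSingularities.Theorems.WildQuotientsWildQuotientResolutionJordanThreeK3Charts
import Summits.ResolutionOfSingularities.ResolutionOfSingularities.Theorems.WildQuotientsWildQuotientResolutionJordanThreeCentre
import Summits.ResolutionOfSingularities.ResolutionOfSingularities.Theorems.WildQuotientsWildQuotientResolutionJordanThreeLaw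
import Literature.AlgebraicGeometry.Resolution.BlowupStalkEmbedding

/-!
# Rung V3, one-blow-up model: the divisorial hypothesis `hdiv` for `Bl_{K₃} 𝔸ⁿ`

(crux stmt-ResolutionOfSingularities-15640 `WildQuotients.WildQuotientResolution`, line `Sketch`,
sector `|G| = p`; rung V3 of `L/w45c/CHAIN.md` v4, model of record = ONE blow-up of `𝔸ⁿ` along
`K₃ = (x_a⁴, x_a³x_b, x_a²x_b³, x_a x_b⁴, x_b⁶)` (res-L1-w45c-lead-1 RULING 2026-08-27T01:07:58Z;
design memo `L/res-L1-w45c-lead-1/V3-K3-DESIGN.md` §4); [OURS · L1 W4.5c] — NOT a statement of any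
manuscript; replaces the role of no printed item.)

`isPrincipal_stalkAug_liftAction_k3`: for the `J₃` datum `σ x_b = x_b + x_a`, `σ x_c = x_c + x_b`
(identity on the other coordinates, `a, b, c` distinct) over a field of characteristic `3`, any action
`ρ : ⟨σ⟩ →* Aut 𝔸ⁿ` with the affine-quotient law `ρ g = Spec (g⁻¹)`, any INTEGRAL blow-up
`π : V → 𝔸ⁿ` along the ideal sheaf of `K₃` with `⟨σ⟩`-stable ideal sheaf (`hJ`), every `g ∈ ⟨σ⟩` and
every point `v ∈ V` fixed by the lifted automorphism `(liftAction ρ) g`: the augmentation ideal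
`⟨(stalkSpecializes ≫ (liftAction ρ g)^♯_v) y - y : y ∈ 𝒪_{V,v}⟩` is PRINCIPAL — the `hdiv` clause of
`CyclicTransfer.cyclicDivisorialTransfer_of_card` for this model. This is the `K₃` twin of
`TerminalBlowup.isPrincipal_stalkAug_liftAction_spec` (p469646, invariant centres). Proof: `g = 1`
lifts to the identity (augmentation ideal `⊥`); for `g ≠ 1` the stalk `𝒪_{V,v}` is a localisation of
a Rees chart `j ∈ Fin 5` of `𝒪_{𝔸ⁿ,s}[K₃/c_j]` and the augmentation ideal is the base part plus the
moves of the four chart generators (`TerminalBlowup.exists_reesChart_span_stalkAug_eq_sup`, p481478);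
the base part is `(x_a, x_b)·𝒪_{V,v}` (`JordanThree.span_smul_sub_eq_centre` / `smul_sub_mem_centre`,
p480312, for `g⁻¹`, read on germs by `TerminalBlowup.stalkAction_germ` and the localisation
`B → 𝒪_{𝔸ⁿ,s}`); `g⁻¹` acts by a `J₃` law with unit multiplier (`JordanThree.exists_law_of_ne_one'`,
p481560); `x_a, x_b ≠ 0` in the domain `𝒪_{V,v}` (`IsBlowup.stalkMap_injective`); and the five
chart identities `JordanThree.k3_chart<j>_span_eq` (p482636) give `⊤, (u²), ⊤, (x_b), (x_b)`.
-/

-- single-problem summit: the doubled namespace component `ResolutionOfSingularities` is forced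
set_option linter.dupNamespace false

noncomputable section

open CategoryTheory AlgebraicGeometry TopologicalSpace IsLocalRing MvPolynomial
open Literature.AlgebraicGeometry.Resolution
open scoped Pointwise

namespace Summit.ResolutionOfSingularities.ResolutionOfSingularities.Theorems.WildQuotientResolution.JordanThree

universe u

/-- Bookkeeping: a chart relation `ψ c_l = ψ c_j · u` read through `χ` with `χ ∘ ψ = ι'` becomes
`ι' c_j · χ u = ι' c_l` (stated abstractly so that no rewriting happens inside the Rees chart types).
[folklore] -/
theorem map_chartRel {R A S : Type*} [CommRing R] [CommRing A] [CommRing S] (ψ : R →+* A)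
    (χ : A →+* S) (ι' : R →+* S) (hχ : ∀ r, χ (ψ r) = ι' r) {cj cl : R} {u : A}
    (hu : ψ cl = ψ cj * u) : ι' cj * χ u = ι' cl := by
  rw [← hχ, ← hχ, hu, map_mul]

/-- **The five `K₃` charts at once**: in a local domain of characteristic `3`, for every chart
index `j : Fin 5`, the ideal `(x_a, x_b) + (a (e l) - e l : l ≠ j)` of `k3_chart<j>_span_eq` is
principal. (Case split `j = 0, …, 4` by `rcases` on the literal values, so that the subtype
`{l // l ≠ j}` keeps its numeral form.) [folklore] -/
theorem k3_chart_span_isPrincipal {S : Type u} [CommRing S] [IsDomain S] [IsLocalRing S]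
    (xa xb m : S) (hxa : xa ≠ 0) (hxb : xb ≠ 0) (hm : IsUnit m) (h3 : (3 : S) = 0)
    (a : S →+* S) (ha : a xa = xa) (hb : a xb = xb + m * xa) (j : Fin 5)
    (e : {l : Fin 5 // l ≠ j} → S)
    (he : ∀ l, (![xa ^ 4, xa ^ 3 * xb, xa ^ 2 * xb ^ 3, xa * xb ^ 4, xb ^ 6] : Fin 5 → S) j * e l =
      (![xa ^ 4, xa ^ 3 * xb, xa ^ 2 * xb ^ 3, xa * xb ^ 4, xb ^ 6] : Fin 5 → S) l.1) :
    (Ideal.span ({xa, xb} : Set S) ⊔ Ideal.span (Set.range fun l => a (e l) - e l)).IsPrincipal := by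
  have hj : j = 0 ∨ j = 1 ∨ j = 2 ∨ j = 3 ∨ j = 4 := by fin_cases j <;> simp
  rcases hj with rfl | rfl | rfl | rfl | rfl
  · rw [k3_chart0_span_eq xa xb m hxa hm a ha hb e (fun l => he l)]
    exact ⟨⟨1, by simp⟩⟩
  · rw [k3_chart1_span_eq xa xb m hxa hxb hm h3 a ha hb e (fun l => he l)]
    exact ⟨⟨_, rfl⟩⟩
  · rw [k3_chart2_span_eq xa xb hxa hxb a e (fun l => he l)]
    exact ⟨⟨1, by simp⟩⟩
  · rw [k3_chart3_span_eq xa xb m hxa hxb h3 a ha hb e (fun l => he l)]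
    exact ⟨⟨_, rfl⟩⟩
  · rw [k3_chart4_span_eq xa xb m hxa hxb a ha hb e (fun l => he l)]
    exact ⟨⟨_, rfl⟩⟩

set_option maxHeartbeats 400000 in
/-- **The divisorial hypothesis `hdiv` for the one-blow-up model `Bl_{K₃} 𝔸ⁿ` of the `J₃` datum in
characteristic 3** (see the module docstring): at every point fixed by the lifted action of any
`g ∈ ⟨σ⟩`, the stalk augmentation ideal is principal. [OURS · L1 W4.5c]
[cite: KiralyLutkebohmert2013, Thm 2] [cite: StacksProject, Tag 0804] -/
theorem isPrincipal_stalkAug_liftAction_k3 (k : Type) [Field k] [CharP k 3] (n : ℕ)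
    (σ : MvPolynomial (Fin n) k ≃ₐ[k] MvPolynomial (Fin n) k) (a b c : Fin n)
    (hab : a ≠ b) (hac : a ≠ c) (hb : σ (X b) = X b + X a) (hc : σ (X c) = X c + X b)
    (hσ : ∀ i, i ≠ b → i ≠ c → σ (X i) = X i)
    (ρ : ↥(Subgroup.zpowers σ) →* Aut (Spec (CommRingCat.of (MvPolynomial (Fin n) k))))
    (hρ : ∀ g : ↥(Subgroup.zpowers σ), (ρ g).hom = Spec.map (CommRingCat.ofHom
      ((MulSemiringAction.toRingEquiv (↥(Subgroup.zpowers σ)) (MvPolynomial (Fin n) k) g⁻¹ :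
        MvPolynomial (Fin n) k ≃+* MvPolynomial (Fin n) k) :
          MvPolynomial (Fin n) k →+* MvPolynomial (Fin n) k)))
    {V : Scheme.{0}} {π : V ⟶ Spec (CommRingCat.of (MvPolynomial (Fin n) k))}
    (hπ : IsBlowup π (affineBlowup.idealSheaf (Ideal.span (Set.range
      (![X a ^ 4, X a ^ 3 * X b, X a ^ 2 * X b ^ 3, X a * X b ^ 4, X b ^ 6] :
        Fin 5 → MvPolynomial (Fin n) k)))))
    (hJ : ∀ g : ↥(Subgroup.zpowers σ), (affineBlowup.idealSheaf (Ideal.span (Set.range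
      (![X a ^ 4, X a ^ 3 * X b, X a ^ 2 * X b ^ 3, X a * X b ^ 4, X b ^ 6] :
        Fin 5 → MvPolynomial (Fin n) k)))).comap (ρ g).hom =
      affineBlowup.idealSheaf (Ideal.span (Set.range
        (![X a ^ 4, X a ^ 3 * X b, X a ^ 2 * X b ^ 3, X a * X b ^ 4, X b ^ 6] :
          Fin 5 → MvPolynomial (Fin n) k))))
    [IsIntegral V] (g : ↥(Subgroup.zpowers σ)) (v : V)
    (hv : ((hπ.liftAction ρ hJ) g).hom.base v = v) :
    (Ideal.span (Set.range fun y =>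
      (V.presheaf.stalkSpecializes (specializes_of_eq hv) ≫
        ((hπ.liftAction ρ hJ) g).hom.stalkMap v).hom y - y)).IsPrincipal := by
  classical
  by_cases hg1 : g = 1
  · -- `g = 1`: the lift is the identity and the ideal is `⊥`
    subst hg1
    have hlift : ((hπ.liftAction ρ hJ) 1).hom = 𝟙 V := by rw [map_one]; rfl
    have key : ∀ (f : V ⟶ V) (_ : f = 𝟙 V) (hvf : f.base v = v),
        Ideal.span (Set.range fun s : V.presheaf.stalk v =>
          (V.presheaf.stalkSpecializes (specializes_of_eq hvf) ≫ f.stalkMap v).hom s - s) = ⊥ := by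
      intro f hf hvf
      subst hf
      refine Ideal.span_eq_bot.mpr ?_
      rintro _ ⟨s, rfl⟩
      change ((𝟙 V : V ⟶ V).stalkMap v).hom
        ((V.presheaf.stalkSpecializes (specializes_of_eq hvf)).hom s) - s = 0
      erw [Scheme.Hom.stalkMap_id]
      rw [sub_eq_zero]
      exact stalkSpecializes_self_apply V.presheaf v _ s
    rw [key _ hlift hv]
    exact bot_isPrincipal
  · -- `g ≠ 1`
    -- `π♯_v` is injective (the base `𝔸ⁿ` is integral and Noetherian)
    have hπinj : Function.Injective (π.stalkMap v).hom := IsBlowup.stalkMap_injective hπ v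
    -- notation
    let K3v : Fin 5 → MvPolynomial (Fin n) k :=
      ![X a ^ 4, X a ^ 3 * X b, X a ^ 2 * X b ^ 3, X a * X b ^ 4, X b ^ 6]
    have hg' : (g⁻¹ : ↥(Subgroup.zpowers σ)) ≠ 1 := fun h => hg1 (inv_eq_one.mp h)
    -- the germ map `B → 𝒪_{𝔸ⁿ,s}`, `s = π v`
    let γ : MvPolynomial (Fin n) k →+*
        (Spec (CommRingCat.of (MvPolynomial (Fin n) k))).presheaf.stalk (π.base v) :=
      ((Scheme.ΓSpecIso (CommRingCat.of (MvPolynomial (Fin n) k))).inv ≫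
        (Spec (CommRingCat.of (MvPolynomial (Fin n) k))).presheaf.germ ⊤ (π.base v) trivial).hom
    set φ : MvPolynomial (Fin n) k →+* MvPolynomial (Fin n) k :=
      ((MulSemiringAction.toRingEquiv (↥(Subgroup.zpowers σ)) (MvPolynomial (Fin n) k) g⁻¹ :
        MvPolynomial (Fin n) k ≃+* MvPolynomial (Fin n) k) :
          MvPolynomial (Fin n) k →+* MvPolynomial (Fin n) k) with hφ
    have hφapp : ∀ F : (MvPolynomial (Fin n) k), φ F = g⁻¹ • F := fun F => rfl
    have key : ∀ (f : Spec (CommRingCat.of (MvPolynomial (Fin n) k)) ⟶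
          Spec (CommRingCat.of (MvPolynomial (Fin n) k)))
        (_ : f = Spec.map (CommRingCat.ofHom φ)) (hsf : f.base (π.base v) = π.base v)
        (F : MvPolynomial (Fin n) k),
        ((Spec (CommRingCat.of (MvPolynomial (Fin n) k))).presheaf.stalkSpecializes
            (specializes_of_eq hsf) ≫
          f.stalkMap (π.base v)).hom (γ F) = γ (φ F) := by
      intro f hf hsf F
      subst hf
      exact TerminalBlowup.stalkAction_germ φ (π.base v) hsf F
    -- the germs of the generators generate the stalk of the centre
    have hcK : Ideal.span (Set.range fun j => γ (K3v j)) =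
        stalkIdeal (affineBlowup.idealSheaf (Ideal.span (Set.range K3v))) (π.base v) := by
      rw [stalkIdeal_eq_map_germ (affineBlowup.idealSheaf (Ideal.span (Set.range K3v)))
        ⟨⊤, isAffineOpen_top (Spec (CommRingCat.of (MvPolynomial (Fin n) k)))⟩ trivial]
      change _ = Ideal.map _ ((Scheme.IdealSheafData.ofIdealTop _).ideal
        ⟨⊤, isAffineOpen_top (Spec (CommRingCat.of (MvPolynomial (Fin n) k)))⟩)
      rw [ideal_ofIdealTop_top, Ideal.map_map, Ideal.map_span, ← Set.range_comp]
      rfl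
    -- the chart package at `v`
    obtain ⟨hs, j, 𝔴, χ, hχ, hloc, hab', haug⟩ :=
      TerminalBlowup.exists_reesChart_span_stalkAug_eq_sup hπ (hπ.liftAction_hom_comp ρ hJ g) v hv
        (fun j => γ (K3v j)) hcK
    set aH := V.presheaf.stalkSpecializes (specializes_of_eq hv) ≫
      ((hπ.liftAction ρ hJ) g).hom.stalkMap v with haH
    set bH := (Spec (CommRingCat.of (MvPolynomial (Fin n) k))).presheaf.stalkSpecializes
        (specializes_of_eq hs) ≫
      (ρ g).hom.stalkMap (π.base v) with hbH
    have hbγ : ∀ F : MvPolynomial (Fin n) k, bH.hom (γ F) = γ (g⁻¹ • F) :=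
      fun F => key _ (hρ g) hs F
    -- `ι : B → 𝒪_{V,v}` and its equivariance
    let ι : (MvPolynomial (Fin n) k) →+* V.presheaf.stalk v := (π.stalkMap v).hom.comp γ
    have hιapp : ∀ F : (MvPolynomial (Fin n) k), ι F = (π.stalkMap v).hom (γ F) := fun F => rfl
    have hιa : ∀ F : (MvPolynomial (Fin n) k), aH.hom (ι F) = ι (g⁻¹ • F) := fun F => by
      rw [hιapp, hιapp, hab', hbγ]
    -- `ι` is injective: `x_a, x_b ≠ 0` in `𝒪_{V,v}`
    letI : Algebra (MvPolynomial (Fin n) k)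
        ((Spec (CommRingCat.of (MvPolynomial (Fin n) k))).presheaf.stalk (π.base v)) :=
      StructureSheaf.stalkAlgebra (↑(CommRingCat.of (MvPolynomial (Fin n) k))) (π.base v)
    haveI : IsLocalization.AtPrime
        ((Spec (CommRingCat.of (MvPolynomial (Fin n) k))).presheaf.stalk (π.base v))
        (π.base v).asIdeal :=
      StructureSheaf.IsLocalization.to_stalk (↑(CommRingCat.of (MvPolynomial (Fin n) k))) (π.base v)
    have halg : ∀ F : MvPolynomial (Fin n) k, algebraMap (MvPolynomial (Fin n) k)
        ((Spec (CommRingCat.of (MvPolynomial (Fin n) k))).presheaf.stalk (π.base v)) F = γ F :=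
      fun F => rfl
    have hγinj : Function.Injective γ :=
      IsLocalization.injective (M := (π.base v).asIdeal.primeCompl)
        ((Spec (CommRingCat.of (MvPolynomial (Fin n) k))).presheaf.stalk (π.base v))
        (Ideal.primeCompl_le_nonZeroDivisors _)
    have hιinj : Function.Injective ι := hπinj.comp hγinj
    have hxa : ι (X a) ≠ 0 := fun h =>
      MvPolynomial.X_ne_zero (R := k) a (hιinj (h.trans (map_zero ι).symm))
    have hxb : ι (X b) ≠ 0 := fun h =>
      MvPolynomial.X_ne_zero (R := k) b (hιinj (h.trans (map_zero ι).symm))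
    -- the law of `g⁻¹`
    obtain ⟨m₀, q₀, hm₀, hga, hgb, -, -⟩ :=
      exists_law_of_ne_one' k n σ a b c hab hac hb hc hσ g⁻¹ hg'
    have ha : aH.hom (ι (X a)) = ι (X a) := by
      rw [hιa]
      change ι (((g⁻¹ : ↥(Subgroup.zpowers σ)) :
        MvPolynomial (Fin n) k ≃ₐ[k] MvPolynomial (Fin n) k) (X a)) = _
      rw [hga]
    have hbb : aH.hom (ι (X b)) = ι (X b) + ι (C m₀) * ι (X a) := by
      rw [hιa]
      change ι (((g⁻¹ : ↥(Subgroup.zpowers σ)) :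
        MvPolynomial (Fin n) k ≃ₐ[k] MvPolynomial (Fin n) k) (X b)) = _
      rw [hgb, map_add, map_mul]
    have hm : IsUnit (ι (C m₀)) := by
      refine IsUnit.of_mul_eq_one (ι (C m₀⁻¹)) ?_
      rw [← map_mul, ← map_mul, mul_inv_cancel₀ hm₀, map_one, map_one]
    have h3 : (3 : V.presheaf.stalk v) = 0 := by
      have h3B : (3 : (MvPolynomial (Fin n) k)) = 0 := by
        have h := CharP.cast_eq_zero (MvPolynomial (Fin n) k) 3
        simpa using h
      rw [← map_ofNat ι 3, h3B, map_zero]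
    -- the base part of the augmentation ideal: `(x_a, x_b)·𝒪_{V,v}`
    have haugB : Ideal.span (Set.range fun r => bH.hom r - r) =
        (Ideal.span ({X a, X b} : Set (MvPolynomial (Fin n) k))).map γ := by
      apply le_antisymm
      · have hagree :
            (Ideal.Quotient.mk ((Ideal.span ({X a, X b} : Set (MvPolynomial (Fin n) k))).map γ)).comp
              bH.hom =
            Ideal.Quotient.mk ((Ideal.span ({X a, X b} : Set (MvPolynomial (Fin n) k))).map γ) := by
          apply IsLocalization.ringHom_ext (π.base v).asIdeal.primeCompl
            (S := (Spec (CommRingCat.of (MvPolynomial (Fin n) k))).presheaf.stalk (π.base v))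
          refine RingHom.ext fun F => ?_
          simp only [RingHom.comp_apply, halg]
          rw [hbγ, Ideal.Quotient.eq, ← map_sub]
          exact Ideal.mem_map_of_mem γ (smul_sub_mem_centre k n σ a b c hb hc hσ g⁻¹ F)
        refine Ideal.span_le.mpr ?_
        rintro _ ⟨r, rfl⟩
        have h := RingHom.congr_fun hagree r
        rw [RingHom.comp_apply, Ideal.Quotient.eq] at h
        exact h
      · rw [← span_smul_sub_eq_centre k n σ a b c hab hac hb hc hσ g⁻¹ hg', Ideal.map_span]
        refine Ideal.span_le.mpr ?_
        rintro _ ⟨_, ⟨F, rfl⟩, rfl⟩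
        refine Ideal.subset_span ⟨γ F, ?_⟩
        change bH.hom (γ F) - γ F = γ (g⁻¹ • F - F)
        rw [map_sub, hbγ]
    have hbase : (Ideal.span (Set.range fun r => bH.hom r - r)).map (π.stalkMap v).hom =
        Ideal.span ({ι (X a), ι (X b)} : Set (V.presheaf.stalk v)) := by
      rw [haugB, Ideal.map_map, Ideal.map_span, Set.image_pair]
    -- the chart relations, read in `𝒪_{V,v}`
    have hK3ι : ∀ l : Fin 5, ι (K3v l) = (![ι (X a) ^ 4, ι (X a) ^ 3 * ι (X b),
        ι (X a) ^ 2 * ι (X b) ^ 3, ι (X a) * ι (X b) ^ 4, ι (X b) ^ 6] :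
          Fin 5 → V.presheaf.stalk v) l := by
      intro l
      have hl : l = 0 ∨ l = 1 ∨ l = 2 ∨ l = 3 ∨ l = 4 := by fin_cases l <;> simp
      rcases hl with rfl | rfl | rfl | rfl | rfl
      · show ι (X a ^ 4) = ι (X a) ^ 4
        rw [map_pow]
      · show ι (X a ^ 3 * X b) = ι (X a) ^ 3 * ι (X b)
        rw [map_mul, map_pow]
      · show ι (X a ^ 2 * X b ^ 3) = ι (X a) ^ 2 * ι (X b) ^ 3
        rw [map_mul, map_pow, map_pow]
      · show ι (X a * X b ^ 4) = ι (X a) * ι (X b) ^ 4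
        rw [map_mul, map_pow]
      · show ι (X b ^ 6) = ι (X b) ^ 6
        rw [map_pow]
    have he : ∀ l : {l : Fin 5 // l ≠ j},
        (![ι (X a) ^ 4, ι (X a) ^ 3 * ι (X b), ι (X a) ^ 2 * ι (X b) ^ 3, ι (X a) * ι (X b) ^ 4,
            ι (X b) ^ 6] : Fin 5 → V.presheaf.stalk v) j *
          χ (chartGen (fun j => γ (K3v j)) j l.1) =
        (![ι (X a) ^ 4, ι (X a) ^ 3 * ι (X b), ι (X a) ^ 2 * ι (X b) ^ 3, ι (X a) * ι (X b) ^ 4,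
            ι (X b) ^ 6] : Fin 5 → V.presheaf.stalk v) l.1 := by
      intro l
      have h : ι (K3v j) * χ (chartGen (fun j => γ (K3v j)) j l.1) = ι (K3v l.1) :=
        map_chartRel (chartBase (fun j => γ (K3v j)) j) χ (π.stalkMap v).hom hχ
          (reesChartBase_apply_eq_mul_chartGen (fun j => γ (K3v j)) j l.1)
      exact (congrArg (· * χ (chartGen (fun j => γ (K3v j)) j l.1)) (hK3ι j)).symm.trans
        (h.trans (hK3ι l.1))
    -- assemble
    have key2 := k3_chart_span_isPrincipal (ι (X a)) (ι (X b)) (ι (C m₀)) hxa hxb hm h3 aH.hom ha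
      hbb j (fun l => χ (chartGen (fun j => γ (K3v j)) j l.1)) he
    have haug' := haug.trans (congrArg (fun I => I ⊔ Ideal.span (Set.range
      fun l : {l : Fin 5 // l ≠ j} => aH.hom (χ (chartGen (fun j => γ (K3v j)) j l.1)) -
        χ (chartGen (fun j => γ (K3v j)) j l.1))) hbase)
    rw [haug']
    exact key2

end Summit.ResolutionOfSingularities.ResolutionOfSingularities.Theorems.WildQuotientResolution.JordanThree

end
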